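import Literature.MathematicalPhysics.QuantumFieldTheory.Federbush1986.PhaseCellIVGeomConstruction4

/-!
# Federbush, *A phase cell approach to Yang–Mills theory. IV. The choice of variables* (CMP **114** (1988) 317–343) —
# Appendix A, THEOREM A.1 p. 339 at EVERY cap `c₁` (the large-data clause, print's steps 1)–4), (A.9)–(A.16) pp. 340–341),
# PROVED under the embedded reading for every COMPACT uniformly Lipschitz-retractable target `M ⊆ Rᵗ`, and hypothesis-free
# for the model targets `S^{t−1}` (`U(1) = S¹`, `SU(2) ≅ S³`)

statement-level skeleton of published theorems with citation tags; proofs where landed; nothing here is a claim about the Yang–Mills mass gap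

Cell `lit-balaban`, reader/typer block **r19** (F4 fold owner), SKELETON rows `F4.ThmA.1` and `F4.EqA.9-A.16` of
`run/shared/lean/pub/lit-balaban/lit-balaban-r19/ROWS-F4.md`; closes the one item of Appendix A left open by
`PhaseCellIVThmA1Small` (p265091/p265328: small-data clause + the reduction (A.9)–(A.10)) — GAPS.md §G-F4-01 ADDENDUM 5.

**Source.** P. Federbush, Commun. Math. Phys. **114** (1988) 317–343 [bib `Federbush1988PhaseCellIV`; doi:10.1007/bf01225039;
lit store `paper:doi-10-1007-bf01225039`; journal page = PDF page + 316], pp. 339–341 [PDF 23–25] read as images (renders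
`lit-balaban-r19/renders/f4/f4-p023.png … p025.png`).  Verbatim, p. 339: «**Theorem A.1.** For each constant `c₁`, there is a
constant `c₂ = c₂(c₁)`, such that if `f` is any homotopically trivial mapping from `∂D` into `M` satisfying `Λ₁(f) ≤ c₁` (A.1)
there is an extension of `f`, `f^e`, mapping `D` into `M`, satisfying `Λ₁(f^e) ≤ c₂Λ₁(f)` (A.2).»  p. 340: «With the
considerations above for the situation with `Λ₁(f) < ε`, the proof of Theorem A.1 is now reduced to proving the existence of a
`c′₂(c₁)` so that if `Λ₁(f) ≤ c₁` (A.9), `f^e` may be found satisfying `Λ₁(f^e) ≤ c′₂` (A.10).  The germ of the idea that will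
be used to prove this, is to look at simplicial approximations, of a sort, and note that only a finite number of mappings must
be considered.  A bound for each of the finite set will imply (A.10).  We consider simplicial subdivisions of `∂D` and of `M`.
We require the inclusion maps of simplices to be differentiable.  For sufficiently fine subdivision – we hold these truths to
be self-evident: 1) That each `f` satisfying (A.9) may be associated to a "good" simplicial approximation `f^a` [in a sense to
be specified in 2)].  2) That there is a `c″₁` such that there is a mapping `f₁^e`, for each `f`, `f₁^e : ∂D × I → M` (A.11)
with `f₁^e(x, 0) = f(x)`, `f₁^e(x, 1) = f^a(x)` (A.12) and satisfying `Λ₁(f₁^e) ≤ c″₁` (A.13) (`c″₁` independent of `f`.)  This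
map `f₁^e` may be chosen so that `f₁^e_x(t) = f₁^e(x, t)` is uniform motion along a geodesic.»  p. 341: «3) That there is a
`c″₂` such that there is a mapping `f₂^e`, for each `f^a`, `f₂^e : ∂D × I → M` (A.14) with `f₂^e(x, 0) = f^a(x)`,
`f₂^e(x, 1) = x₀(f)` (A.15) [i.e. `f₂^e(x, 1)` is a trivial map].  And `f₂^e` satisfies `Λ₁(f₂^e) ≤ c″₂` (A.16) (`c″₂` independent
of `f`).  Remember there are only a finite number of `f^a`'s.  4) That 2) and 3) imply our theorem [verify the claim in the
sentence containing (A.9) and (A.10)].»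

**What this file proves, and how (print's architecture 1)–4); Mathlib roads where print says «self-evident»).**
The decl of record `PhaseCellIVAppA.ThmA1` (p242861) is typed over Mathlib's abstract Riemannian-manifold class (no compact
instance inhabitable); as for Theorems A.2–A.4 the embedded reading `ThmA1EmbAt n t M c₁` / `ThmA1Emb n t M` (p265091:
`M ⊆ Rᵗ` with the ambient distance, «homotopically trivial» = `ContinuousMap.Nullhomotopic`) is the statement proved:
* `thmA1Emb_of_retract` — **`ThmA1Emb n t M` for every cube dimension `n` and every COMPACT `M ⊆ Rᵗ` admitting a uniform
  Lipschitz neighbourhood retraction** (`r > 0`, `P` `L`-Lipschitz on `{dist(·, M) < r}` with values in `M`, `P = id` on `M` —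
  every compact `C²` submanifold, in particular print's «compact differentiable manifold (without boundary)» once embedded in
  `Rᵗ`; the tubular-neighbourhood theorem itself is not in Mathlib and is carried as these hypotheses, exactly as in
  `PhaseCellIVThmA2Embedded` / `PhaseCellIVThmA1Small` / `PhaseCellIVThmA3Retract`);
* `thmA1Emb_sphere (n t)` — the model targets `S^{t−1} ⊂ ℝᵗ`, hypothesis-free (radial retraction `r = ½`, `L = 4`);
  `thmA1Emb_circle` (`U(1) = S¹`), `thmA1Emb_threeSphere` (`SU(2) ≅ S³`).
Proof = print's reduction (`thmA1EmbAt_of_retract_of_large`, p265328) + the large-data bound (A.9)–(A.10)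
(`large_data_bound`), itself assembled from print's four steps:
* 1) «only a finite number of mappings must be considered»: `ThmA1Large.exists_finite_net` — the homotopically trivial maps
  `∂D → M` with `Λ₁ ≤ c₁` have a FINITE `δ`-net in `d^M` consisting of such maps, by ARZELÀ–ASCOLI (Mathlib
  `BoundedContinuousFunction.arzela_ascoli`: equi-Lipschitz maps of the compact `∂D` into the compact `M` are totally bounded) —
  in place of print's finitely many «good simplicial approximations `f^a`» (no simplicial structure on `M` is used; `δ = ε_M`,
  the threshold of Theorem A.2);
* 2) the bounded-`Λ₁` interpolation `f ↔ f^a` («uniform motion along a geodesic» between two `d^M`-close maps) and its use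
  in 4): this is Theorem A.2 on the cube = Geometric Construction 4, PROVED in `PhaseCellIVGeomConstruction4`
  (`geomConstruction4_of_retract`, p266275; the geodesic is the retracted chord): an extension `f_i^e` of a representative
  `f_i` with `d^M(f_i, f) ≤ ε_M` yields an extension of `f` with `Λ₁ ≤ c(Λ₁(f_i^e) + d^M(f_i, f) + Λ₁(f))`;
* 3) a null-homotopy of each representative with bounded `Λ₁`: `ThmA1Large.exists_lipschitz_nullhomotopy` — ANY
  null-homotopy `H : I × ∂D → M` of a Lipschitz map is replaced by a LIPSCHITZ one: approximate `H` uniformly within `r/4` by a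
  Lipschitz map into `Rᵗ` (Lipschitz functions are dense in `C(X, ℝ)` for a compact metric `X` — Stone–Weierstrass, Mathlib
  `ContinuousMap.exists_mem_subalgebra_near_continuous_of_separatesPoints`; `ThmA1Large.exists_lipschitz_near`), re-pin the
  two ends linearly in the time variable, retract with `P`;
* 4) assembly: the cone over a Lipschitz null-homotopy is a Lipschitz extension to the ball
  (`ThmA1Large.exists_extension_ball_of_lipschitz_nullhomotopy`: `f^e(y) = H(2(1 − |y|), y/|y|)`, constant on `|y| ≤ ½`,
  glued across `|y| = ½`), transported `B ↔ D` along the bi-Lipschitz boundary-preserving maps `CubeBall.toBall` / `toCube`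
  of p266275 (`ThmA1Large.exists_lipschitz_extension`); finitely many representatives ⇒ a common bound `Λ*` on their
  extensions, whence `c′₂ = c(Λ* + ε_M + c₁)`.
As in print, `c₂(c₁)` comes from a finiteness argument and is not explicit.  Nothing printed is contradicted; the deviation
from print is confined to HOW the «self-evident» steps 1) and 3) are realised (total boundedness of the equi-Lipschitz family
instead of simplicial approximation; density + retraction instead of simplicial homotopies).
-/

namespace Literature.MathematicalPhysics.QuantumFieldTheory.Federbush1986

noncomputable section

open scoped NNReal ENNReal
open Set Metric

namespace PhaseCellIVAppA

namespace ThmA1Large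

/-! ## 1. Lipschitz functions are dense in `C(X, ℝ)` and in `C(X, Rᵗ)` for a compact metric space `X` (Stone–Weierstrass) -/

section Density

variable {X : Type*} [MetricSpace X] [CompactSpace X]

/-- **Lipschitz functions are dense in `C(X, ℝ)`** (`X` compact metric; Stone–Weierstrass, Mathlib
`ContinuousMap.exists_mem_subalgebra_near_continuous_of_separatesPoints`, applied to the subalgebra of Lipschitz functions —
closed under products because the factors are bounded, separating points through `dist(·, x)`): every continuous real function
is uniformly within `ε` of a Lipschitz one.  Used for step 3): print's homotopies (A.11)/(A.14) have bounded `Λ₁`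
(«self-evident» for simplicial maps); a merely continuous null-homotopy is first made Lipschitz.
[cite: Federbush1988PhaseCellIV, (A.14)–(A.16) p. 341] -/
theorem exists_lipschitz_near_real (f : X → ℝ) (hf : Continuous f) {ε : ℝ} (hε : 0 < ε) :
    ∃ g : X → ℝ, (∃ K : ℝ≥0, LipschitzWith K g) ∧ ∀ x, |g x - f x| < ε := by
  -- the subalgebra of Lipschitz functions
  let A : Subalgebra ℝ C(X, ℝ) :=
    { carrier := {F | ∃ K : ℝ≥0, LipschitzWith K F}
      mul_mem' := by
        rintro F F' ⟨K, hK⟩ ⟨K', hK'⟩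
        refine ⟨‖F‖₊ * K' + ‖F'‖₊ * K, LipschitzWith.of_dist_le_mul fun x y => ?_⟩
        have h1 := hK.dist_le_mul x y
        have h2 := hK'.dist_le_mul x y
        rw [Real.dist_eq] at h1 h2 ⊢
        have hb1 : |F x| ≤ ‖F‖ := by rw [← Real.norm_eq_abs]; exact F.norm_coe_le_norm x
        have hb2 : |F' y| ≤ ‖F'‖ := by rw [← Real.norm_eq_abs]; exact F'.norm_coe_le_norm y
        rw [ContinuousMap.mul_apply, ContinuousMap.mul_apply]
        calc |F x * F' x - F y * F' y| = |F x * (F' x - F' y) + (F x - F y) * F' y| := by ring_nf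
          _ ≤ |F x * (F' x - F' y)| + |(F x - F y) * F' y| := abs_add_le _ _
          _ = |F x| * |F' x - F' y| + |F x - F y| * |F' y| := by rw [abs_mul, abs_mul]
          _ ≤ ‖F‖ * (K' * dist x y) + K * dist x y * ‖F'‖ := by gcongr
          _ = ((‖F‖₊ * K' + ‖F'‖₊ * K : ℝ≥0) : ℝ) * dist x y := by push_cast; ring
      add_mem' := by
        rintro F F' ⟨K, hK⟩ ⟨K', hK'⟩
        exact ⟨K + K', hK.add hK'⟩
      algebraMap_mem' := fun c => ⟨0, LipschitzWith.of_dist_le_mul fun x y => by simp⟩ }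
  have hA : A.SeparatesPoints := by
    intro x y hxy
    refine ⟨_, ⟨⟨fun z => dist z x, continuous_id.dist continuous_const⟩, ⟨1, LipschitzWith.dist_left x⟩, rfl⟩, ?_⟩
    simp only [ContinuousMap.coe_mk, dist_self]
    exact fun h => hxy (dist_eq_zero.mp h.symm).symm
  obtain ⟨⟨g, hg⟩, hgf⟩ := ContinuousMap.exists_mem_subalgebra_near_continuous_of_separatesPoints A hA f hf ε hε
  refine ⟨g, hg, fun x => ?_⟩
  have := hgf x
  rwa [Real.norm_eq_abs] at this

/-- **Lipschitz maps are dense in `C(X, Rᵗ)`** (coordinatewise from the real case; the `ℓ²` reassembly costs `√t`).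
[cite: Federbush1988PhaseCellIV, (A.14)–(A.16) p. 341] -/
theorem exists_lipschitz_near {t : ℕ} (f : X → EuclideanSpace ℝ (Fin t)) (hf : Continuous f) {η : ℝ} (hη : 0 < η) :
    ∃ g : X → EuclideanSpace ℝ (Fin t), (∃ K : ℝ≥0, LipschitzWith K g) ∧ ∀ x, ‖g x - f x‖ ≤ η := by
  have hden : 0 < Real.sqrt t + 1 := by positivity
  set η' : ℝ := η / (Real.sqrt t + 1) with hη'
  have hη'0 : 0 < η' := div_pos hη hden
  have hi : ∀ i : Fin t, ∃ g : X → ℝ, (∃ K : ℝ≥0, LipschitzWith K g) ∧ ∀ x, |g x - f x i| < η' := fun i =>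
    exists_lipschitz_near_real (fun x => f x i) ((EuclideanSpace.proj i).continuous.comp hf) hη'0
  choose g hgK hgf using hi
  choose K hK using hgK
  refine ⟨fun x => WithLp.toLp 2 fun i => g i x, ⟨_, (PiLp.lipschitzWith_toLp 2 (fun _ : Fin t => ℝ)).comp
    (LipschitzWith.of_dist_le_mul (K := ∑ i, K i) fun x y => ?_)⟩, fun x => ?_⟩
  · refine (dist_pi_le_iff (by positivity)).2 fun i => ((hK i).dist_le_mul x y).trans ?_
    gcongr
    exact Finset.single_le_sum (f := K) (fun j _ => zero_le) (Finset.mem_univ i)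
  · have h := ThmA1Small.norm_le_sqrt_mul (WithLp.toLp 2 (fun i => g i x) - f x) hη'0.le fun i => by
      rw [PiLp.sub_apply, Real.norm_eq_abs]
      exact (hgf i x).le
    refine h.trans ?_
    rw [hη', mul_div_assoc', div_le_iff₀ hden]
    nlinarith [Real.sqrt_nonneg t]

end Density

section Tools

/-! ### A Lipschitz product rule (for the end corrections of step 3)) -/

/-- A product of a bounded Lipschitz scalar and a bounded Lipschitz vector function is Lipschitz.
[cite: Federbush1988PhaseCellIV, (A.14)–(A.16) p. 341] -/
theorem lipschitzWith_smul_of_bound {Y : Type*} [PseudoMetricSpace Y] {E : Type*} [NormedAddCommGroup E] [NormedSpace ℝ E]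
    {c : Y → ℝ} {v : Y → E} {Kc Kv Bc Bv : ℝ≥0} (hc : LipschitzWith Kc c) (hv : LipschitzWith Kv v)
    (hcB : ∀ y, |c y| ≤ Bc) (hvB : ∀ y, ‖v y‖ ≤ Bv) : LipschitzWith (Kc * Bv + Bc * Kv) (fun y => c y • v y) := by
  refine LipschitzWith.of_dist_le_mul fun y y' => ?_
  rw [dist_eq_norm]
  have h1 : c y • v y - c y' • v y' = (c y - c y') • v y + c y' • (v y - v y') := by
    rw [sub_smul, smul_sub]; abel
  rw [h1]
  calc ‖(c y - c y') • v y + c y' • (v y - v y')‖ ≤ ‖(c y - c y') • v y‖ + ‖c y' • (v y - v y')‖ := norm_add_le _ _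
    _ = |c y - c y'| * ‖v y‖ + |c y'| * ‖v y - v y'‖ := by rw [norm_smul, norm_smul, Real.norm_eq_abs, Real.norm_eq_abs]
    _ ≤ Kc * dist y y' * Bv + Bc * (Kv * dist y y') := by
        gcongr ?_ * ?_ + ?_ * ?_
        · rw [← Real.dist_eq]; exact hc.dist_le_mul y y'
        · exact hvB y
        · exact hcB y'
        · rw [← dist_eq_norm]; exact hv.dist_le_mul y y'
    _ = (Kc * Bv + Bc * Kv : ℝ≥0) * dist y y' := by push_cast; ring

end Tools

/-! ## 2. Step 3): from a null-homotopy to a LIPSCHITZ null-homotopy (retractable target) -/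

section Nullhomotopy

variable {t : ℕ} {M : Set (EuclideanSpace ℝ (Fin t))} {r : ℝ} {L : ℝ≥0}
  {P : EuclideanSpace ℝ (Fin t) → EuclideanSpace ℝ (Fin t)}
  {X : Type*} [MetricSpace X] [CompactSpace X]

/-- **Step 3) with bounded `Λ₁`** («there is a `c″₂` such that there is a mapping `f₂^e`, for each `f^a`, `f₂^e : ∂D × I → M`
(A.14) with `f₂^e(x, 0) = f^a(x)`, `f₂^e(x, 1) = x₀(f)` (A.15) … `Λ₁(f₂^e) ≤ c″₂` (A.16)»): for a uniformly Lipschitz-retractable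
`M ⊆ Rᵗ`, EVERY null-homotopy of a Lipschitz map `g : X → M` (`X` compact metric — here `∂B` or `∂D`) can be replaced by a
LIPSCHITZ null-homotopy `Hl : ℝ × X → M` (time clamped to `[0, 1]`; `Hl(0, ·) = g`, `Hl(s, ·) = m₀` for `s ≥ 1`): approximate the
given homotopy within `r/4` by a Lipschitz map into `Rᵗ` (`exists_lipschitz_near`), re-pin the two ends by the corrections
`(1 − s)(g − G₁(0, ·)) + s(m₀ − G₁(1, ·))` (each of size `≤ r/4`), so the result stays in the `3r/4`-neighbourhood of `M`, and
retract with `P`.  The Lipschitz constant obtained depends on the homotopy (print: one constant per `f^a`, finitely many `f^a`).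
[cite: Federbush1988PhaseCellIV, step 3) (A.14)–(A.16) p. 341] -/
theorem exists_lipschitz_nullhomotopy (hr : 0 < r) (hPL : LipschitzOnWith L P {y | infDist y M < r})
    (hPM : MapsTo P {y | infDist y M < r} M) (hPid : ∀ y ∈ M, P y = y)
    (g : C(X, ↥M)) (hg : g.Nullhomotopic) {K : ℝ≥0} (hgK : LipschitzWith K g) :
    ∃ (Hl : ℝ × X → EuclideanSpace ℝ (Fin t)) (K' : ℝ≥0) (m₀ : EuclideanSpace ℝ (Fin t)),
      m₀ ∈ M ∧ LipschitzWith K' Hl ∧ (∀ p, Hl p ∈ M) ∧ (∀ x, Hl (0, x) = g x) ∧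
      ∀ s : ℝ, 1 ≤ s → ∀ x, Hl (s, x) = m₀ := by
  classical
  obtain ⟨m₀, ⟨H⟩⟩ := hg
  -- the homotopy as an ambient-valued continuous map on the compact metric space `I × X`
  set Hv : unitInterval × X → EuclideanSpace ℝ (Fin t) := fun p => (H p : EuclideanSpace ℝ (Fin t)) with hHv
  have hHvc : Continuous Hv := continuous_subtype_val.comp H.continuous
  have hHvM : ∀ p, Hv p ∈ M := fun p => (H p).2
  set η : ℝ := r / 4 with hη
  have hη0 : 0 < η := by positivity
  obtain ⟨G₁, ⟨K₁, hK₁⟩, hG₁⟩ := exists_lipschitz_near Hv hHvc hη0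
  -- the clamped time parameter
  set σ : ℝ → unitInterval := Set.projIcc 0 1 zero_le_one with hσ
  have hσL : LipschitzWith 1 σ := LipschitzWith.projIcc _
  have hσ0 : σ 0 = 0 := Subtype.ext (by simp [hσ])
  have hσ1 : ∀ s : ℝ, 1 ≤ s → σ s = 1 := fun s hs => Subtype.ext (by simp [hσ, Set.projIcc, hs])
  -- the two end corrections
  set a : X → EuclideanSpace ℝ (Fin t) := fun x => (g x : EuclideanSpace ℝ (Fin t)) - G₁ (0, x) with ha_def
  set b : X → EuclideanSpace ℝ (Fin t) := fun x => (m₀ : EuclideanSpace ℝ (Fin t)) - G₁ (1, x) with hb_def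
  have ha : ∀ x, ‖a x‖ ≤ η := fun x => by
    have h1 : Hv (0, x) = g x := by rw [hHv]; exact congrArg Subtype.val (H.apply_zero x)
    rw [ha_def]; simp only
    rw [← h1, norm_sub_rev]; exact hG₁ (0, x)
  have hb : ∀ x, ‖b x‖ ≤ η := fun x => by
    have h1 : Hv (1, x) = m₀ := by rw [hHv]; exact congrArg Subtype.val (H.apply_one x)
    rw [hb_def]; simp only
    rw [← h1, norm_sub_rev]; exact hG₁ (1, x)
  have hG₁0 : LipschitzWith K₁ (fun x : X => G₁ (0, x)) :=
    (hK₁.comp (LipschitzWith.prodMk_left (0 : unitInterval))).weaken (by simp)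
  have hG₁1 : LipschitzWith K₁ (fun x : X => G₁ (1, x)) :=
    (hK₁.comp (LipschitzWith.prodMk_left (1 : unitInterval))).weaken (by simp)
  have hgv : LipschitzWith K (fun x : X => (g x : EuclideanSpace ℝ (Fin t))) :=
    (LipschitzWith.subtype_val M).comp hgK |>.weaken (by simp)
  have haL : LipschitzWith (K + K₁) a := hgv.sub hG₁0
  have hbL : LipschitzWith (0 + K₁) b := (LipschitzWith.const _).sub hG₁1
  -- the corrected Lipschitz homotopy, before retraction
  set H₂ : ℝ × X → EuclideanSpace ℝ (Fin t) :=
    fun p => G₁ (σ p.1, p.2) + (1 - (σ p.1 : ℝ)) • a p.2 + (σ p.1 : ℝ) • b p.2 with hH₂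
  set η' : ℝ≥0 := ⟨η, hη0.le⟩ with hη'
  have hpair : LipschitzWith 1 (fun p : ℝ × X => (σ p.1, p.2)) :=
    ((hσL.comp (LipschitzWith.prod_fst (α := ℝ) (β := X))).prodMk (LipschitzWith.prod_snd (α := ℝ) (β := X))).weaken
      (by simp)
  have hc2 : LipschitzWith 1 (fun p : ℝ × X => (σ p.1 : ℝ)) :=
    ((LipschitzWith.subtype_val _).comp (hσL.comp (LipschitzWith.prod_fst (α := ℝ) (β := X)))).weaken (by simp)
  have hc1 : LipschitzWith 1 (fun p : ℝ × X => 1 - (σ p.1 : ℝ)) :=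
    ((LipschitzWith.const (1 : ℝ)).sub hc2).weaken (by simp)
  have hc1B : ∀ p : ℝ × X, |1 - (σ p.1 : ℝ)| ≤ (1 : ℝ≥0) := fun p => by
    have := (σ p.1).2
    rw [NNReal.coe_one, abs_le]; constructor <;> linarith [this.1, this.2]
  have hc2B : ∀ p : ℝ × X, |(σ p.1 : ℝ)| ≤ (1 : ℝ≥0) := fun p => by
    have := (σ p.1).2
    rw [NNReal.coe_one, abs_le]; constructor <;> linarith [this.1, this.2]
  have hT1 : LipschitzWith (K₁ * 1) (fun p : ℝ × X => G₁ (σ p.1, p.2)) := hK₁.comp hpair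
  have hT2 : LipschitzWith (1 * η' + 1 * (K + K₁)) (fun p : ℝ × X => (1 - (σ p.1 : ℝ)) • a p.2) :=
    lipschitzWith_smul_of_bound hc1 (haL.comp (LipschitzWith.prod_snd (α := ℝ) (β := X)) |>.weaken (by simp))
      hc1B (fun p => ha p.2)
  have hT3 : LipschitzWith (1 * η' + 1 * (0 + K₁)) (fun p : ℝ × X => (σ p.1 : ℝ) • b p.2) :=
    lipschitzWith_smul_of_bound hc2 (hbL.comp (LipschitzWith.prod_snd (α := ℝ) (β := X)) |>.weaken (by simp))
      hc2B (fun p => hb p.2)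
  obtain ⟨K₂, hH₂L⟩ : ∃ K₂, LipschitzWith K₂ H₂ := ⟨_, (hT1.add hT2).add hT3⟩
  -- `H₂` stays in the tube
  have hH₂near : ∀ p : ℝ × X, dist (H₂ p) (Hv (σ p.1, p.2)) ≤ 3 * η := fun p => by
    rw [dist_eq_norm, hH₂]
    simp only
    have e1 : G₁ (σ p.1, p.2) + (1 - (σ p.1 : ℝ)) • a p.2 + (σ p.1 : ℝ) • b p.2 - Hv (σ p.1, p.2) =
        (G₁ (σ p.1, p.2) - Hv (σ p.1, p.2)) + (1 - (σ p.1 : ℝ)) • a p.2 + (σ p.1 : ℝ) • b p.2 := by abel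
    rw [e1]
    calc ‖G₁ (σ p.1, p.2) - Hv (σ p.1, p.2) + (1 - (σ p.1 : ℝ)) • a p.2 + (σ p.1 : ℝ) • b p.2‖
        ≤ ‖G₁ (σ p.1, p.2) - Hv (σ p.1, p.2)‖ + ‖(1 - (σ p.1 : ℝ)) • a p.2‖ + ‖(σ p.1 : ℝ) • b p.2‖ :=
          norm_add₃_le
      _ ≤ η + 1 * η + 1 * η := by
          rw [norm_smul, norm_smul, Real.norm_eq_abs, Real.norm_eq_abs]
          gcongr
          · exact hG₁ _
          · exact_mod_cast hc1B p
          · exact ha p.2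
          · exact_mod_cast hc2B p
          · exact hb p.2
      _ = 3 * η := by ring
  have hH₂U : ∀ p : ℝ × X, H₂ p ∈ {y | infDist y M < r} := fun p => by
    show infDist (H₂ p) M < r
    calc infDist (H₂ p) M ≤ dist (H₂ p) (Hv (σ p.1, p.2)) := infDist_le_dist_of_mem (hHvM _)
      _ ≤ 3 * η := hH₂near p
      _ < r := by rw [hη]; linarith
  -- retract
  refine ⟨fun p => P (H₂ p), L * K₂, m₀, m₀.2, ?_, fun p => hPM (hH₂U p), fun x => ?_, fun s hs x => ?_⟩
  · exact lipschitzOnWith_univ.1 (hPL.comp hH₂L.lipschitzOnWith fun p _ => hH₂U p)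
  · have h1 : H₂ (0, x) = g x := by
      rw [hH₂]; simp only [hσ0]
      rw [ha_def]; simp
    show P (H₂ (0, x)) = g x
    rw [h1]; exact hPid _ (g x).2
  · have h1 : H₂ (s, x) = m₀ := by
      rw [hH₂]; simp only [hσ1 s hs]
      rw [hb_def]; simp
    show P (H₂ (s, x)) = m₀
    rw [h1]; exact hPid _ m₀.2

end Nullhomotopy

/-! ## 3. Step 3) ⇒ step 4): a Lipschitz null-homotopy is a Lipschitz EXTENSION to the ball (cone over `∂B`), hence to the cube -/

section Cone

variable {t : ℕ} {M : Set (EuclideanSpace ℝ (Fin t))} {r : ℝ} {L : ℝ≥0}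
  {P : EuclideanSpace ℝ (Fin t) → EuclideanSpace ℝ (Fin t)} {n : ℕ}

open ThmA2

/-- The CONE over a Lipschitz null-homotopy: if `Hl : ℝ × ∂B → M` is `K'`-Lipschitz with `Hl(0, ·) = g` and `Hl(s, ·) = m₀` for
`s ≥ 1`, then `g^e(y) := Hl(2(1 − |y|), y/|y|)` is a `4K'`-Lipschitz extension of `g` to the closed unit ball (constant `m₀` on
`|y| ≤ ½`; the direction map `y/|y|` is `4`-Lipschitz on `|y| ≥ ½`; glued across `|y| = ½`).  This is how the homotopies
(A.11)/(A.14) on `∂D × I` become maps on `D` in step 4).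
[cite: Federbush1988PhaseCellIV, (A.11)–(A.16) and step 4) pp. 340–341] -/
theorem exists_extension_ball_of_lipschitz_nullhomotopy
    (g : ↥(sphere (0 : EuclideanSpace ℝ (Fin n)) 1) → ↥M)
    {Hl : ℝ × ↥(sphere (0 : EuclideanSpace ℝ (Fin n)) 1) → EuclideanSpace ℝ (Fin t)} {K' : ℝ≥0}
    {m₀ : EuclideanSpace ℝ (Fin t)} (hm₀ : m₀ ∈ M) (hHl : LipschitzWith K' Hl) (hHlM : ∀ p, Hl p ∈ M)
    (hHl0 : ∀ z, Hl (0, z) = g z) (hHl1 : ∀ s : ℝ, 1 ≤ s → ∀ z, Hl (s, z) = m₀) :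
    ∃ ge : ↥(closedBall (0 : EuclideanSpace ℝ (Fin n)) 1) → ↥M,
      (∀ z : ↥(sphere (0 : EuclideanSpace ℝ (Fin n)) 1), ge ⟨z.1, sphere_subset_closedBall z.2⟩ = g z) ∧
      LipschitzWith (4 * K') ge := by
  classical
  rcases isEmpty_or_nonempty (↥(sphere (0 : EuclideanSpace ℝ (Fin n)) 1)) with he | ⟨⟨z₀⟩⟩
  · refine ⟨fun _ => ⟨m₀, hm₀⟩, fun z => (he.false z).elim, ?_⟩
    exact (LipschitzWith.const _).weaken zero_le
  · -- the direction map into the sphere (any value at the origin — it is never used there)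
    set u : EuclideanSpace ℝ (Fin n) → ↥(sphere (0 : EuclideanSpace ℝ (Fin n)) 1) :=
      fun y => if h : y = 0 then z₀ else ⟨radial y, by rw [mem_sphere_zero_iff_norm, norm_radial h]⟩ with hu
    have hu_of_ne : ∀ {y : EuclideanSpace ℝ (Fin n)} (hy : y ≠ 0), (u y : EuclideanSpace ℝ (Fin n)) = radial y :=
      fun {y} hy => by rw [hu]; simp only [dif_neg hy]
    set Ge : EuclideanSpace ℝ (Fin n) → EuclideanSpace ℝ (Fin t) := fun y => Hl (2 * (1 - ‖y‖), u y) with hGe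
    have hGeM : ∀ y, Ge y ∈ M := fun y => hHlM _
    -- inner region `|y| ≤ ½`: the constant `m₀`
    have hin : ∀ y : EuclideanSpace ℝ (Fin n), ‖y‖ ≤ 1 / 2 → Ge y = m₀ := fun y hy =>
      hHl1 _ (by linarith) _
    have hinL : LipschitzOnWith (4 * K') Ge {y | ‖y‖ ≤ 1 / 2} :=
      LipschitzOnWith.of_dist_le_mul fun y hy y' hy' => by
        rw [hin y hy, hin y' hy', dist_self]; positivity
    -- outer region `½ ≤ |y| ≤ 1`
    have hout : LipschitzOnWith (4 * K') Ge {y | 1 / 2 ≤ ‖y‖ ∧ ‖y‖ ≤ 1} := by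
      refine LipschitzOnWith.of_dist_le_mul fun y hy y' hy' => ?_
      have hy0 : y ≠ 0 := fun h => by have := hy.1; rw [h, norm_zero] at this; linarith
      have hy0' : y' ≠ 0 := fun h => by have := hy'.1; rw [h, norm_zero] at this; linarith
      calc dist (Ge y) (Ge y')
          ≤ K' * dist ((2 * (1 - ‖y‖), u y) : ℝ × ↥(sphere (0 : EuclideanSpace ℝ (Fin n)) 1))
              (2 * (1 - ‖y'‖), u y') := hHl.dist_le_mul _ _
        _ ≤ K' * (4 * dist y y') := by
            gcongr
            rw [Prod.dist_eq, max_le_iff]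
            constructor
            · rw [Real.dist_eq, dist_eq_norm]
              calc |2 * (1 - ‖y‖) - 2 * (1 - ‖y'‖)| = 2 * |‖y'‖ - ‖y‖| := by
                    rw [show 2 * (1 - ‖y‖) - 2 * (1 - ‖y'‖) = 2 * (‖y'‖ - ‖y‖) by ring, abs_mul, abs_two]
                _ ≤ 2 * ‖y' - y‖ := by gcongr; exact abs_norm_sub_norm_le y' y
                _ = 2 * ‖y - y'‖ := by rw [norm_sub_rev]
                _ ≤ 4 * ‖y - y'‖ := by nlinarith [norm_nonneg (y - y')]
            · rw [Subtype.dist_eq, hu_of_ne hy0, hu_of_ne hy0', dist_eq_norm, dist_eq_norm]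
              calc ‖radial y - radial y'‖ ≤ 2 / (1 / 2) * ‖y - y'‖ := norm_radial_sub_radial_le (by norm_num) hy.1 hy'.1
                _ = 4 * ‖y - y'‖ := by norm_num
        _ = (4 * K' : ℝ≥0) * dist y y' := by push_cast; ring
    have hGeL : LipschitzOnWith (4 * K') Ge (closedBall 0 1) := lipschitzOnWith_closedBall_of_glue hinL hout
    refine ⟨fun y => ⟨Ge y.1, hGeM y.1⟩, fun z => ?_, ?_⟩
    · apply Subtype.ext
      show Ge z.1 = g z
      have hz1 : ‖(z : EuclideanSpace ℝ (Fin n))‖ = 1 := by simp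
      have hz0 : (z : EuclideanSpace ℝ (Fin n)) ≠ 0 := fun h => by rw [h, norm_zero] at hz1; exact zero_ne_one hz1
      have huz : u z.1 = z := Subtype.ext (by rw [hu_of_ne hz0, radial_of_norm_eq_one hz1])
      rw [hGe]
      simp only [hz1, sub_self, mul_zero]
      rw [huz]
      exact hHl0 z
    · exact LipschitzWith.of_dist_le_mul fun y y' => by
        rw [Subtype.dist_eq, Subtype.dist_eq y]
        exact hGeL.dist_le_mul y.1 y.2 y'.1 y'.2

open CubeBall in
/-- **Step 4) for ONE map**: every null-homotopic Lipschitz `f : ∂D → M` (`M` uniformly Lipschitz-retractable) has SOME Lipschitz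
extension `f^e : D → M` — transport `∂D ↔ ∂B` along `toCube`/`toBall` (p266275), Lipschitz null-homotopy (§2), cone (above).
No bound on `Λ₁(f^e)` in terms of `Λ₁(f)` is claimed here: print's point is that only FINITELY MANY such maps are needed.
[cite: Federbush1988PhaseCellIV, steps 3)–4) (A.14)–(A.16) p. 341] -/
theorem exists_lipschitz_extension (hr : 0 < r) (hPL : LipschitzOnWith L P {y | infDist y M < r})
    (hPM : MapsTo P {y | infDist y M < r} M) (hPid : ∀ y ∈ M, P y = y)
    (f : C(↥(cubeBoundary n), ↥M)) (hf : f.Nullhomotopic) {K : ℝ≥0} (hfK : LipschitzWith K f) :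
    ∃ (fe : ↥(unitCube n) → ↥M) (Ke : ℝ≥0),
      (∀ x : ↥(cubeBoundary n), fe ⟨x.1, cubeBoundary_subset n x.2⟩ = f x) ∧ LipschitzWith Ke fe := by
  -- transport `∂B → ∂D`
  set Ψs : C(↥(sphere (0 : EuclideanSpace ℝ (Fin n)) 1), ↥(cubeBoundary n)) :=
    ⟨fun z => ⟨toCube z.1, toCube_mem_cubeBoundary z.2⟩,
      (lipschitzWith_toCube.continuous.comp continuous_subtype_val).subtype_mk _⟩ with hΨs
  have hΨsL : LipschitzWith ((3 / 2 : ℝ≥0) * n) Ψs := LipschitzWith.of_dist_le_mul fun z z' => by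
    rw [Subtype.dist_eq, Subtype.dist_eq z]
    exact lipschitzWith_toCube.dist_le_mul z.1 z'.1
  set g : C(↥(sphere (0 : EuclideanSpace ℝ (Fin n)) 1), ↥M) := f.comp Ψs with hg_def
  have hg : g.Nullhomotopic := hf.comp_left Ψs
  have hgK : LipschitzWith (K * ((3 / 2 : ℝ≥0) * n)) g := hfK.comp hΨsL
  obtain ⟨Hl, K', m₀, hm₀, hHl, hHlM, hHl0, hHl1⟩ := exists_lipschitz_nullhomotopy hr hPL hPM hPid g hg hgK
  obtain ⟨ge, hge, hgeL⟩ := exists_extension_ball_of_lipschitz_nullhomotopy (g : _ → ↥M) hm₀ hHl hHlM hHl0 hHl1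
  -- transport `D → B`
  set Φc : ↥(unitCube n) → ↥(closedBall (0 : EuclideanSpace ℝ (Fin n)) 1) :=
    fun x => ⟨toBall x.1, toBall_mem_closedBall x.2⟩ with hΦc
  have hΦcL : LipschitzWith 6 Φc := LipschitzWith.of_dist_le_mul fun x x' => by
    rw [Subtype.dist_eq, Subtype.dist_eq x]
    exact lipschitzWith_toBall.dist_le_mul x.1 x'.1
  refine ⟨ge ∘ Φc, 4 * K' * 6, fun x => ?_, hgeL.comp hΦcL⟩
  have hS : toBall x.1 ∈ sphere (0 : EuclideanSpace ℝ (Fin n)) 1 := toBall_mem_sphere x.2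
  have h1 : (ge ∘ Φc) ⟨x.1, cubeBoundary_subset n x.2⟩ = ge ⟨toBall x.1, sphere_subset_closedBall hS⟩ := rfl
  have h3 : g ⟨toBall x.1, hS⟩ = f x := by
    show f (Ψs ⟨toBall x.1, hS⟩) = f x
    congr 1
    exact Subtype.ext (toCube_toBall x.1)
  rw [h1, hge ⟨toBall x.1, hS⟩, h3]

end Cone

/-! ## 4. Step 1): only FINITELY MANY maps need be considered — an `ε`-net of the null-homotopic `c₁`-Lipschitz maps (Arzelà–Ascoli) -/

section Net

open BoundedContinuousFunction

variable {t : ℕ} {M : Set (EuclideanSpace ℝ (Fin t))} {n : ℕ}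

/-- `∂D` is compact (closed and bounded in `ℝⁿ`: `D` lies in the ball of radius `√n`), so that Arzelà–Ascoli applies to maps
`∂D → M`. [cite: Federbush1988PhaseCellIV, Theorem A.1 p. 339] -/
theorem isCompact_cubeBoundary (n : ℕ) : IsCompact (cubeBoundary n) := by
  have hD : IsCompact (unitCube n) := by
    refine Metric.isCompact_of_isClosed_isBounded (isClosed_unitCube n)
      ((isBounded_closedBall (x := (0 : EuclideanSpace ℝ (Fin n))) (r := Real.sqrt n)).subset fun x hx => ?_)
    rw [mem_closedBall, dist_zero_right]
    simpa using ThmA1Small.norm_le_sqrt_mul x zero_le_one fun i => by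
      have h := hx i
      rw [Real.norm_eq_abs, abs_le]
      constructor <;> linarith [h.1, h.2]
  exact hD.of_isClosed_subset isClosed_frontier (cubeBoundary_subset n)

/-- **Step 1)** «only a finite number of mappings must be considered» (p. 340): for `M` compact, the homotopically trivial maps
`f : ∂D → M` with `Λ₁(f) ≤ c₁` admit a FINITE `δ`-net in the sup distance `d^M`, consisting of such maps (Arzelà–Ascoli:
equi-Lipschitz maps from the compact `∂D` into the compact `M` are totally bounded; Mathlib
`BoundedContinuousFunction.arzela_ascoli`).  The net replaces print's finitely many «good simplicial approximations `f^a`».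
[cite: Federbush1988PhaseCellIV, step 1) and the sentence before it, p. 340] -/
theorem exists_finite_net (hM : IsCompact M) (n : ℕ) (c₁ : ℝ≥0) {δ : ℝ} (hδ : 0 < δ) :
    ∃ (ι : Type) (_ : Fintype ι) (rep : ι → C(↥(cubeBoundary n), ↥M)),
      (∀ i, (rep i).Nullhomotopic ∧ LipschitzWith c₁ (rep i)) ∧
      ∀ f : C(↥(cubeBoundary n), ↥M), f.Nullhomotopic → LipschitzWith c₁ f →
        ∃ i, ∀ x, dist (f x) (rep i x) < δ := by
  classical
  haveI : CompactSpace ↥(cubeBoundary n) := isCompact_iff_compactSpace.mp (isCompact_cubeBoundary n)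
  set val : C(↥M, EuclideanSpace ℝ (Fin t)) := ⟨Subtype.val, continuous_subtype_val⟩ with hval
  set toB : C(↥(cubeBoundary n), ↥M) → (↥(cubeBoundary n) →ᵇ EuclideanSpace ℝ (Fin t)) :=
    fun f => BoundedContinuousFunction.mkOfCompact (val.comp f) with htoB
  have htoB_apply : ∀ f x, toB f x = (f x : EuclideanSpace ℝ (Fin t)) := fun f x => rfl
  set S : Set C(↥(cubeBoundary n), ↥M) := {f | f.Nullhomotopic ∧ LipschitzWith c₁ f} with hS
  set A : Set (↥(cubeBoundary n) →ᵇ EuclideanSpace ℝ (Fin t)) := toB '' S with hA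
  have hin : ∀ (F : ↥(cubeBoundary n) →ᵇ EuclideanSpace ℝ (Fin t)) (x : ↥(cubeBoundary n)), F ∈ A → F x ∈ M := by
    rintro F x ⟨f, -, rfl⟩
    exact (f x).2
  have hlip : ∀ F ∈ A, LipschitzWith c₁ F := by
    rintro F ⟨f, hf, rfl⟩
    exact LipschitzWith.of_dist_le_mul fun x y => by
      rw [htoB_apply, htoB_apply, ← Subtype.dist_eq]
      exact hf.2.dist_le_mul x y
  have hequi : Equicontinuous ((↑) : A → ↥(cubeBoundary n) → EuclideanSpace ℝ (Fin t)) :=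
    (LipschitzWith.uniformEquicontinuous ((↑) : A → ↥(cubeBoundary n) → EuclideanSpace ℝ (Fin t)) c₁
      fun F => hlip F.1 F.2).equicontinuous
  have hcomp : IsCompact (closure A) := BoundedContinuousFunction.arzela_ascoli M hM A hin hequi
  have htb : TotallyBounded A := hcomp.totallyBounded.subset subset_closure
  obtain ⟨tnet, htA, htfin, hcover⟩ := Metric.finite_approx_of_totallyBounded htb δ hδ
  haveI : Fintype ↥tnet := htfin.fintype
  have hrep : ∀ i : ↥tnet, ∃ f : C(↥(cubeBoundary n), ↥M), f ∈ S ∧ toB f = i.1 := fun i => htA i.2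
  choose rep hrepS hrepB using hrep
  refine ⟨↥tnet, inferInstance, rep, fun i => hrepS i, fun f hf hfK => ?_⟩
  have hF : toB f ∈ A := ⟨f, ⟨hf, hfK⟩, rfl⟩
  obtain ⟨F₀, hF₀, hdist⟩ := mem_iUnion₂.mp (hcover hF)
  refine ⟨⟨F₀, hF₀⟩, fun x => ?_⟩
  calc dist (f x) (rep ⟨F₀, hF₀⟩ x) = dist (toB f x) (toB (rep ⟨F₀, hF₀⟩) x) := by
        rw [htoB_apply, htoB_apply, Subtype.dist_eq]
    _ = dist (toB f x) (F₀ x) := by rw [hrepB]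
    _ ≤ dist (toB f) F₀ := BoundedContinuousFunction.dist_coe_le_dist x
    _ < δ := mem_ball.mp hdist

end Net

end ThmA1Large

/-! ## 5. Steps 2) and 4): assembly — Theorem A.1 at EVERY cap for compact uniformly Lipschitz-retractable `M` -/

section Assembly

open ThmA1Large

variable {t : ℕ} {M : Set (EuclideanSpace ℝ (Fin t))} {r : ℝ} {L : ℝ≥0}
  {P : EuclideanSpace ℝ (Fin t) → EuclideanSpace ℝ (Fin t)}

/-- **(A.9)–(A.10), the large-data bound, PROVED** (compact uniformly Lipschitz-retractable `M`): for every `c₁` there is `c′₂`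
such that every homotopically trivial `f : ∂D → M` with `Λ₁(f) ≤ c₁` (A.9) has an extension `f^e : D → M` with `Λ₁(f^e) ≤ c′₂`
(A.10).  Steps: 1) a finite `ε_M`-net `{f_i}` of such maps (`exists_finite_net`, `ε_M` = the threshold of Geometric Construction
4 = Theorem A.2 on the cube); 3)–4) one Lipschitz extension `f_i^e` per net point (`exists_lipschitz_extension`), finitely many,
hence a common bound `Λ* = max_i Λ₁(f_i^e)`; 2)+4) for a general `f`, `d^M(f_i, f) ≤ ε_M` for some `i`, and Construction 4
(p266275: «uniform motion along a geodesic» between the nearby maps, (A.11)–(A.13)) turns `f_i^e` into an extension of `f`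
with `Λ₁ ≤ c(Λ* + ε_M + c₁) =: c′₂`.
[cite: Federbush1988PhaseCellIV, (A.9)–(A.16), steps 1)–4) pp. 340–341] -/
theorem large_data_bound (hM : IsCompact M) (hr : 0 < r) (hPL : LipschitzOnWith L P {y | infDist y M < r})
    (hPM : MapsTo P {y | infDist y M < r} M) (hPid : ∀ y ∈ M, P y = y) (n : ℕ) (c₁ : ℝ≥0) :
    ∃ cl : ℝ≥0, ∀ f : C(↥(cubeBoundary n), ↥M), f.Nullhomotopic → lipConst f ≤ c₁ →
      ∃ fe : ↥(unitCube n) → ↥M,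
        (∀ x : ↥(cubeBoundary n), fe ⟨x.1, cubeBoundary_subset n x.2⟩ = f x) ∧ lipConst fe ≤ cl := by
  classical
  obtain ⟨εG, hεG, cG, HG⟩ := geomConstruction4_of_retract (k := n) hr hPL hPM hPid
  obtain ⟨ι, _, rep, hrep, hnet⟩ := exists_finite_net hM n c₁ (δ := (εG : ℝ)) (by exact_mod_cast hεG)
  have hext : ∀ i, ∃ (fe : ↥(unitCube n) → ↥M) (Ke : ℝ≥0),
      (∀ x : ↥(cubeBoundary n), fe ⟨x.1, cubeBoundary_subset n x.2⟩ = rep i x) ∧ LipschitzWith Ke fe := fun i =>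
    exists_lipschitz_extension hr hPL hPM hPid (rep i) (hrep i).1 (hrep i).2
  choose fe Ke hfe hfeL using hext
  set Kmax : ℝ≥0 := Finset.univ.sup Ke with hKmax
  refine ⟨cG * (Kmax + εG + c₁), fun f hf hΛ => ?_⟩
  have hfK : LipschitzWith c₁ f := lipConst_le_iff.mp hΛ
  obtain ⟨i, hi⟩ := hnet f hf hfK
  have hsd : supDist (rep i : ↥(cubeBoundary n) → ↥M) f ≤ εG := by
    refine iSup_le fun x => ?_
    have h1 : dist (rep i x) (f x) ≤ εG := by rw [dist_comm]; exact (hi x).le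
    rw [edist_dist]
    exact (ENNReal.ofReal_le_ofReal h1).trans_eq ENNReal.ofReal_coe_nnreal
  obtain ⟨fe₂, hfe₂, -, hΛ₂⟩ := HG (rep i) f (fe i) (hfe i) hsd
  refine ⟨fe₂, hfe₂, hΛ₂.trans ?_⟩
  have h1 : lipConst (fe i) ≤ Kmax :=
    (lipConst_le_of_lipschitzWith (hfeL i)).trans (by exact_mod_cast Finset.le_sup (f := Ke) (Finset.mem_univ i))
  calc (cG : ℝ≥0∞) * (lipConst (fe i) + supDist (rep i : ↥(cubeBoundary n) → ↥M) f + lipConst (f : ↥(cubeBoundary n) → ↥M))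
      ≤ cG * (Kmax + εG + c₁) := by gcongr
    _ = ((cG * (Kmax + εG + c₁) : ℝ≥0) : ℝ≥0∞) := by push_cast; ring

/-- **THEOREM A.1 (embedded reading) AT EVERY CAP `c₁`, PROVED for every COMPACT uniformly Lipschitz-retractable `M ⊆ Rᵗ`**:
the small-data clause (`thmA1EmbAt_of_retract`, p265091) and the large-data bound (`large_data_bound`) combined by print's
reduction (A.9)–(A.10) (`thmA1EmbAt_of_retract_of_large`, p265328).
[cite: Federbush1988PhaseCellIV, Theorem A.1 (A.1)–(A.2) p. 339; proof pp. 339–341] -/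
theorem thmA1EmbAt_of_compact_retract (hM : IsCompact M) (hr : 0 < r) (hPL : LipschitzOnWith L P {y | infDist y M < r})
    (hPM : MapsTo P {y | infDist y M < r} M) (hPid : ∀ y ∈ M, P y = y) (n : ℕ) (c₁ : ℝ≥0) :
    ThmA1EmbAt n t M c₁ := by
  obtain ⟨ε, -, H⟩ := thmA1EmbAt_of_retract_of_large hr hPL hPM hPid n
  obtain ⟨cl, hcl⟩ := large_data_bound hM hr hPL hPM hPid n c₁
  exact H c₁ cl fun f hf _ hΛ => hcl f hf hΛ

/-- **THEOREM A.1 (embedded reading), PROVED**: `ThmA1Emb n t M` — «For each constant `c₁`, there is a constant `c₂ = c₂(c₁)`,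
such that if `f` is any homotopically trivial mapping from `∂D` into `M` satisfying `Λ₁(f) ≤ c₁` (A.1) there is an extension of
`f`, `f^e`, mapping `D` into `M`, satisfying `Λ₁(f^e) ≤ c₂Λ₁(f)` (A.2)» — for every cube dimension `n` and every COMPACT
`M ⊆ Rᵗ` admitting a uniform Lipschitz neighbourhood retraction (every compact `C²` submanifold; print: «compact differentiable
manifold (without boundary)»).  `c₂(c₁)` is obtained non-constructively (finiteness), as in print.
[cite: Federbush1988PhaseCellIV, Theorem A.1 (A.1)–(A.2) p. 339] -/
theorem thmA1Emb_of_retract (hM : IsCompact M) (hr : 0 < r) (hPL : LipschitzOnWith L P {y | infDist y M < r})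
    (hPM : MapsTo P {y | infDist y M < r} M) (hPid : ∀ y ∈ M, P y = y) (n : ℕ) : ThmA1Emb n t M :=
  fun c₁ => thmA1EmbAt_of_compact_retract hM hr hPL hPM hPid n c₁

/-- **Theorem A.1 (embedded reading) for the MODEL TARGETS `S^{t−1} ⊂ ℝᵗ`**, every `n` and `t`, hypothesis-free (radial
retraction `r = ½`, `L = 4`; for `t = 0` the sphere is empty and no homotopically trivial map into it exists).
[cite: Federbush1988PhaseCellIV, Theorem A.1 (A.1)–(A.2) p. 339] -/
theorem thmA1Emb_sphere (n t : ℕ) : ThmA1Emb n t (sphere (0 : EuclideanSpace ℝ (Fin t)) 1) := by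
  rcases Nat.eq_zero_or_pos t with ht | ht
  · subst ht
    intro c₁
    refine ⟨0, fun f hf _ => ?_⟩
    obtain ⟨y, -⟩ := hf
    exfalso
    have h1 : ‖(y : EuclideanSpace ℝ (Fin 0))‖ = 1 := by simp
    rw [EuclideanSpace.norm_eq] at h1
    simp at h1
  · obtain ⟨hL, hMaps, hid⟩ := ThmA2.radial_retraction_sphere ht
    exact thmA1Emb_of_retract (isCompact_sphere 0 1) (by norm_num) hL hMaps hid n

/-- `U(1) = S¹`: Theorem A.1 on the circle, every cap, every cube dimension. [cite: Federbush1988PhaseCellIV, Theorem A.1 p. 339] -/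
theorem thmA1Emb_circle (n : ℕ) : ThmA1Emb n 2 (sphere (0 : EuclideanSpace ℝ (Fin 2)) 1) :=
  thmA1Emb_sphere n 2

/-- `SU(2) ≅ S³`: Theorem A.1 on the three-sphere, every cap, every cube dimension. [cite: Federbush1988PhaseCellIV, Theorem A.1 p. 339] -/
theorem thmA1Emb_threeSphere (n : ℕ) : ThmA1Emb n 4 (sphere (0 : EuclideanSpace ℝ (Fin 4)) 1) :=
  thmA1Emb_sphere n 4

end Assembly

end PhaseCellIVAppA

end

end Literature.MathematicalPhysics.QuantumFieldTheory.Federbush1986
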